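import Mathlib
import Summits.RiemannHypothesis.RiemannHypothesis.Theorems.IntegerScrewExitGreen
import HarnessLib

/-!
# Route `IntegerScrew` — the Green function of the exit-death chain from BELOW: `Γ(x) ≥ B·log R/log x`
# (CONTINUUM-LIMIT §25.3, the deviation bound)

Companion of `IntegerScrewExitGreen.exitGamma_le`.  With a LOWER Chebyshev-strength Mertens constant `c′`
(`log n − c′ ≤ ψ₁(n)`; the tree's `Literature.NumberTheory.LFunctions.MertensFirstLower` gives `c′ = 1`, kept
here as a hypothesis so that this file only imports built modules):

* `integral_sub_le_sum_log_sub_log_mul` — `∫₀^{log N} f − (log 2)·f(0) ≤ Σ_{2≤n≤N}(log n − log(n−1)) f(log n)` for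
  `f ≥ 0` antitone on `[0, log(N+1)]` (the logarithmic Riemann sum from below: `log n − log(n−1) ≥ log(n+1) − log n`);
* `integral_sub_le_sum_vonMangoldt_div_mul_comp_log` — `∫₀^{log N} f − (c′ + log 2)·f(0) ≤ Σ_{n≤N}(Λ(n)/n) f(log n)`;
* `sum_vonMangoldt_div_mul_inv_sq_ge` — the instance `f(t) = B/(s+t)²`;
* **`le_exitGamma`** — if `1 ≤ Q`, `3 ≤ R`, `0 ≤ B` and
  `B·(log R/(log R − log 2) + (c′ + log 2)·log R/log²(Q+1)) ≤ 1`, then `B·log R/log x ≤ Γ(x)` on `Q < x ≤ R`.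

Together with `exitGamma_le`: `Γ(x) = (log R/log x)·(1 + O(1/((1−δ)² log R)))`, the Green function IS its
continuum value (§25.2–25.3).  RH-free, elementary.  Nothing in this file bears on the truth of RH.
References: CONTINUUM-LIMIT §25.3 (rh-explicit A6-PIVOT); M. Suzuki, J. Lond. Math. Soc. (2) 108 (2023)
1448–1487 [Suzuki2023].
-/

noncomputable section

set_option linter.dupNamespace false -- D-0017: `Summit.<S>.<S>.…` is the designed namespace

namespace Summit.RiemannHypothesis.RiemannHypothesis.Theorems.IntegerScrew

open Finset Real
open ArithmeticFunction (vonMangoldt)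

/-! ### The logarithmic Riemann sum from below -/

/-- For `f ≥ 0` antitone on `[0, log(N+1)]`:
`∫₀^{log N} f − (log 2)·f(0) ≤ Σ_{2 ≤ n ≤ N} (log n − log(n−1)) f(log n)`
(each term is `≥ ∫_{log n}^{log(n+1)} f` because `log n − log(n−1) ≥ log(n+1) − log n` and `f ≤ f(log n)` there;
and `∫₀^{log 2} f ≤ (log 2) f(0)`). -/
theorem integral_sub_le_sum_log_sub_log_mul {N : ℕ} (hN : 1 ≤ N) {f : ℝ → ℝ}
    (hf : AntitoneOn f (Set.Icc 0 (Real.log ((N : ℝ) + 1))))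
    (hf0 : ∀ t ∈ Set.Icc 0 (Real.log ((N : ℝ) + 1)), 0 ≤ f t) :
    (∫ t in (0 : ℝ)..Real.log N, f t) - Real.log 2 * f 0 ≤
      ∑ n ∈ Icc 2 N, (Real.log n - Real.log (n - 1 : ℕ)) * f (Real.log n) := by
  set a : ℕ → ℝ := fun k => Real.log ((k + 1 : ℕ) : ℝ) with ha
  have ha0 : a 0 = 0 := by simp [ha]
  have ha1 : a 1 = Real.log 2 := by simp [ha]; norm_num
  have haN : a N = Real.log ((N : ℝ) + 1) := by simp [ha]
  have hamono : Monotone a := fun i j hij => by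
    simp only [ha]
    exact Real.log_le_log (by positivity) (by exact_mod_cast Nat.succ_le_succ hij)
  have ha_ge : ∀ k, 0 ≤ a k := fun k => ha0 ▸ hamono (Nat.zero_le k)
  have ha_le : ∀ k, k ≤ N → a k ≤ Real.log ((N : ℝ) + 1) := fun k hk => haN ▸ hamono hk
  have hint : ∀ k < N, IntervalIntegrable f MeasureTheory.volume (a k) (a (k + 1)) := by
    intro k hk
    refine (hf.mono ?_).intervalIntegrable
    rw [Set.uIcc_of_le (hamono (Nat.le_succ k))]
    exact Set.Icc_subset_Icc (ha_ge k) (ha_le (k + 1) (by omega))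
  -- ∫₀^{a N} f = Σ_{k<N} ∫_{a k}^{a(k+1)} f
  have hsplit := intervalIntegral.sum_integral_adjacent_intervals hint
  rw [ha0] at hsplit
  -- ∫₀^{log N} ≤ ∫₀^{a N} (f ≥ 0 on [log N, log(N+1)])
  have hlogN_le : Real.log N ≤ a N := by
    rw [haN]; exact Real.log_le_log (by exact_mod_cast (show (0:ℕ) < N by omega)) (by linarith)
  have hmono_int : (∫ t in (0 : ℝ)..Real.log N, f t) ≤ ∫ t in (0 : ℝ)..a N, f t := by
    have hlogN0 : 0 ≤ Real.log (N : ℝ) := Real.log_natCast_nonneg N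
    have hi1 : IntervalIntegrable f MeasureTheory.volume 0 (Real.log N) := by
      refine (hf.mono ?_).intervalIntegrable
      rw [Set.uIcc_of_le hlogN0]
      exact Set.Icc_subset_Icc le_rfl (hlogN_le.trans (le_of_eq haN))
    have hi2 : IntervalIntegrable f MeasureTheory.volume (Real.log N) (a N) := by
      refine (hf.mono ?_).intervalIntegrable
      rw [Set.uIcc_of_le hlogN_le]
      exact Set.Icc_subset_Icc hlogN0 (le_of_eq haN)
    rw [← intervalIntegral.integral_add_adjacent_intervals hi1 hi2]
    have : 0 ≤ ∫ t in Real.log N..a N, f t :=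
      intervalIntegral.integral_nonneg hlogN_le fun t ht =>
        hf0 t ⟨hlogN0.trans ht.1, haN ▸ ht.2⟩
    linarith
  -- split off k = 0: ∫₀^{log 2} f ≤ log 2 · f 0
  have hN1 : (1 : ℝ) ≤ N := by exact_mod_cast hN
  have hlogN1 : 0 ≤ Real.log ((N : ℝ) + 1) := Real.log_nonneg (by linarith)
  have hfirst : ∫ t in a 0..a 1, f t ≤ Real.log 2 * f 0 := by
    rw [ha0, ha1]
    have hlog2 : 0 ≤ Real.log 2 := Real.log_nonneg (by norm_num)
    have h2le : Real.log 2 ≤ Real.log ((N : ℝ) + 1) := Real.log_le_log (by norm_num) (by linarith)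
    calc ∫ t in (0:ℝ)..Real.log 2, f t ≤ ∫ _ in (0:ℝ)..Real.log 2, f 0 := by
          refine intervalIntegral.integral_mono_on hlog2 ?_ intervalIntegrable_const ?_
          · exact (hf.mono (by rw [Set.uIcc_of_le hlog2]; exact Set.Icc_subset_Icc le_rfl h2le)).intervalIntegrable
          · intro t ht
            exact hf ⟨le_rfl, hlogN1⟩ ⟨ht.1, ht.2.trans h2le⟩ ht.1
      _ = Real.log 2 * f 0 := by rw [intervalIntegral.integral_const, smul_eq_mul, sub_zero]
  -- the terms k = 1 … N−1: ∫_{a k}^{a(k+1)} f ≤ (a k − a(k−1)) f(a k)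
  have hterm : ∀ k ∈ Finset.Ico 1 N, ∫ t in a k..a (k + 1), f t ≤ (a k - a (k - 1)) * f (a k) := by
    intro k hk
    have hk' := Finset.mem_Ico.1 hk
    have hle : a k ≤ a (k + 1) := hamono (Nat.le_succ k)
    -- concavity: a(k+1) − a k ≤ a k − a(k−1), i.e. log(k+2) − log(k+1) ≤ log(k+1) − log k
    have hconc : a (k + 1) - a k ≤ a k - a (k - 1) := by
      simp only [ha]
      have hk1 : (1:ℝ) ≤ k := by exact_mod_cast hk'.1
      have e1 : ((k + 1 + 1 : ℕ) : ℝ) = (k:ℝ) + 2 := by push_cast; ring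
      have e2 : ((k + 1 : ℕ) : ℝ) = (k:ℝ) + 1 := by push_cast; ring
      have e3 : ((k - 1 + 1 : ℕ) : ℝ) = (k:ℝ) := by rw [Nat.sub_add_cancel hk'.1]
      rw [e1, e2, e3, ← Real.log_div (by positivity) (by positivity), ← Real.log_div (by positivity) (by positivity)]
      refine Real.log_le_log (by positivity) ?_
      rw [div_le_div_iff₀ (by positivity) (by positivity)]
      nlinarith
    have hfk : 0 ≤ f (a k) := hf0 _ ⟨ha_ge k, ha_le k hk'.2.le⟩
    calc ∫ t in a k..a (k + 1), f t ≤ ∫ _ in a k..a (k + 1), f (a k) := by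
          refine intervalIntegral.integral_mono_on hle (hint k hk'.2) intervalIntegrable_const ?_
          intro t ht
          exact hf ⟨ha_ge k, ha_le k hk'.2.le⟩ ⟨(ha_ge k).trans ht.1, ht.2.trans (ha_le (k+1) hk'.2)⟩ ht.1
      _ = (a (k + 1) - a k) * f (a k) := by rw [intervalIntegral.integral_const, smul_eq_mul]
      _ ≤ (a k - a (k - 1)) * f (a k) := mul_le_mul_of_nonneg_right hconc hfk
  -- reindex the target sum: n = k + 1
  have hre : ∑ n ∈ Icc 2 N, (Real.log n - Real.log (n - 1 : ℕ)) * f (Real.log n) =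
      ∑ k ∈ Finset.Ico 1 N, (a k - a (k - 1)) * f (a k) := by
    refine Finset.sum_nbij' (fun n => n - 1) (fun k => k + 1) ?_ ?_ ?_ ?_ ?_
    · intro n hn; simp only [mem_Icc] at hn; simp only [Finset.mem_Ico]; omega
    · intro k hk; simp only [Finset.mem_Ico] at hk; simp only [mem_Icc]; omega
    · intro n hn; simp only [mem_Icc] at hn; omega
    · intro k hk; omega
    · intro n hn
      simp only [mem_Icc] at hn
      simp only [ha]
      have h1 : (n - 1 + 1 : ℕ) = n := by omega
      have h2 : (n - 1 - 1 + 1 : ℕ) = n - 1 := by omega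
      rw [h1, h2]
  rw [hre]
  have hrange : Finset.range N = insert 0 (Finset.Ico 1 N) := by
    ext k; simp only [Finset.mem_range, Finset.mem_insert, Finset.mem_Ico]; omega
  rw [hrange, Finset.sum_insert (by simp)] at hsplit
  have hsum_le : ∑ k ∈ Finset.Ico 1 N, ∫ t in a k..a (k + 1), f t ≤
      ∑ k ∈ Finset.Ico 1 N, (a k - a (k - 1)) * f (a k) := Finset.sum_le_sum hterm
  linarith

/-- **Abel step from below against the integral** (hypothetical lower constant `c′`): if
`log n − c′ ≤ ψ₁(n)` for `1 ≤ n ≤ N` and `f ≥ 0` is antitone on `[0, log(N+1)]`, then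
`∫₀^{log N} f − (c′ + log 2)·f(0) ≤ Σ_{n ≤ N} (Λ(n)/n) f(log n)`. -/
theorem integral_sub_le_sum_vonMangoldt_div_mul_comp_log {N : ℕ} (hN : 1 ≤ N) {c' : ℝ}
    (hψ : ∀ n, 1 ≤ n → n ≤ N → Real.log n - c' ≤ ∑ k ∈ Icc 1 n, vonMangoldt k / k)
    {f : ℝ → ℝ} (hf : AntitoneOn f (Set.Icc 0 (Real.log ((N : ℝ) + 1))))
    (hf0 : ∀ t ∈ Set.Icc 0 (Real.log ((N : ℝ) + 1)), 0 ≤ f t) :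
    (∫ t in (0 : ℝ)..Real.log N, f t) - (c' + Real.log 2) * f 0 ≤
      ∑ n ∈ Icc 1 N, vonMangoldt n / n * f (Real.log n) := by
  have hlogN1 : 0 ≤ Real.log ((N : ℝ) + 1) := Real.log_nonneg (by
    have : (1:ℝ) ≤ N := by exact_mod_cast hN
    linarith)
  have hφ : ∀ n, 1 ≤ n → n + 1 ≤ N → f (Real.log (n + 1 : ℕ)) ≤ f (Real.log n) := by
    intro n hn hnN
    have h0 : 0 ≤ Real.log n := Real.log_natCast_nonneg n
    have hle : Real.log n ≤ Real.log (n + 1 : ℕ) :=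
      Real.log_le_log (by exact_mod_cast hn) (by exact_mod_cast Nat.le_succ n)
    have hup : Real.log (n + 1 : ℕ) ≤ Real.log ((N : ℝ) + 1) :=
      Real.log_le_log (by positivity) (by exact_mod_cast (show n + 1 ≤ N + 1 by omega))
    exact hf ⟨h0, hle.trans hup⟩ ⟨h0.trans hle, hup⟩ hle
  have hφN : 0 ≤ f (Real.log N) := hf0 _ ⟨Real.log_natCast_nonneg N,
    Real.log_le_log (by exact_mod_cast (show (0:ℕ) < N by omega)) (by linarith)⟩
  have h1 := sum_log_sub_log_mul_le_sum_vonMangoldt_div_mul_of_le_psi (N := N) (c' := c')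
    (φ := fun n => f (Real.log n)) hψ hφ N hN le_rfl
  simp only [Nat.cast_one, Real.log_one] at h1
  have hcorr : 0 ≤ (∑ k ∈ Icc 1 N, vonMangoldt k / k - Real.log N + c') * f (Real.log N) :=
    mul_nonneg (by linarith [hψ N hN le_rfl]) hφN
  have h2 := integral_sub_le_sum_log_sub_log_mul hN hf hf0
  linarith

/-- The instance `f(t) = B/(s+t)²` from below: for `s > 0`, `B ≥ 0`, `N ≥ 1` and the lower constant `c′`:
`B·(1/s − 1/(s + log N)) − (c′ + log 2)·B/s² ≤ Σ_{n ≤ N} (Λ(n)/n)·B/(s + log n)²`. -/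
theorem sum_vonMangoldt_div_mul_inv_sq_ge {N : ℕ} (hN : 1 ≤ N) {c' : ℝ}
    (hψ : ∀ n, 1 ≤ n → n ≤ N → Real.log n - c' ≤ ∑ k ∈ Icc 1 n, vonMangoldt k / k)
    {s B : ℝ} (hs : 0 < s) (hB : 0 ≤ B) :
    B * (1 / s - 1 / (s + Real.log N)) - (c' + Real.log 2) * (B / s ^ 2) ≤
      ∑ n ∈ Icc 1 N, vonMangoldt n / n * (B / (s + Real.log n) ^ 2) := by
  have hlogN : 0 ≤ Real.log N := Real.log_natCast_nonneg N
  set f : ℝ → ℝ := fun t => B / (s + t) ^ 2 with hf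
  have hanti : AntitoneOn f (Set.Icc 0 (Real.log ((N : ℝ) + 1))) := by
    intro x hx y hy hxy
    simp only [hf]
    have hx0 : 0 < s + x := by linarith [hx.1]
    exact div_le_div_of_nonneg_left hB (by positivity) (by nlinarith [hx.1, hy.1])
  have hnn : ∀ t ∈ Set.Icc 0 (Real.log ((N : ℝ) + 1)), 0 ≤ f t := fun t ht => by
    simp only [hf]; positivity
  have h := integral_sub_le_sum_vonMangoldt_div_mul_comp_log hN hψ hanti hnn
  simp only [hf, add_zero] at h
  rw [integral_inv_sq_shift hs hlogN] at h
  exact h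

/-! ### The Green function from below -/

/-- **`Γ(x) ≥ B·log R/log x` (CONTINUUM-LIMIT §25.3, lower half).**  Let `1 ≤ Q`, `3 ≤ R`, `0 ≤ B`, a lower
Mertens constant `c′` (`log n − c′ ≤ ψ₁(n)` for `1 ≤ n ≤ R`), and
`B·(log R/(log R − log 2) + (c′ + log 2)·log R/log²(Q+1)) ≤ 1`.  Then `B·log R/log x ≤ Γ(x)` for `Q < x ≤ R`.
Proof: downward induction; `Γ(x) ≥ 1 + B log R·Σ_{n ≤ R/x}(Λ(n)/n)/(log x + log n)²
≥ 1 + B log R(1/log x − 1/(log x + log⌊R/x⌋)) − (c′ + log 2)B log R/log²x` and `log x + log⌊R/x⌋ ≥ log R − log 2`. -/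
theorem le_exitGamma {R Q : ℕ} (hQ : 1 ≤ Q) (hR : 3 ≤ R) {B c' : ℝ} (hB0 : 0 ≤ B)
    (hψ : ∀ n, 1 ≤ n → n ≤ R → Real.log n - c' ≤ ∑ k ∈ Icc 1 n, vonMangoldt k / k)
    (hB : B * (Real.log R / (Real.log R - Real.log 2) +
      (c' + Real.log 2) * Real.log R / Real.log ((Q : ℝ) + 1) ^ 2) ≤ 1) :
    ∀ x, Q < x → x ≤ R → B * Real.log R / Real.log x ≤ exitGamma R Q x := by
  suffices H : ∀ k x, R + 1 - x = k → Q < x → x ≤ R → B * Real.log R / Real.log x ≤ exitGamma R Q x from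
    fun x hQx hxR => H _ x rfl hQx hxR
  have hR3 : (3 : ℝ) ≤ R := by exact_mod_cast hR
  have hlog2 : 0 < Real.log 2 := Real.log_pos (by norm_num)
  have hL2 : Real.log 2 < Real.log R := Real.log_lt_log (by norm_num) (by linarith)
  set L := Real.log R with hLdef
  have hLpos : 0 < L := hlog2.trans hL2
  -- the lower Mertens constant is ≥ −ψ₁-stuff; we only need c′ + log 2 ≥ 0? Not needed: use hψ at n = 1.
  have hc' : 0 ≤ c' := by
    have := hψ 1 le_rfl (by omega)
    simp [ArithmeticFunction.vonMangoldt_apply_one] at this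
    linarith
  intro k
  induction k using Nat.strong_induction_on with
  | _ k ih =>
    intro x hk hQx hxR
    have hx2 : (2 : ℝ) ≤ x := by exact_mod_cast (show 2 ≤ x by omega)
    have hxR' : (x : ℝ) ≤ R := by exact_mod_cast hxR
    have hlogx : 0 < Real.log x := Real.log_pos (by linarith)
    have hlogQ1 : Real.log ((Q : ℝ) + 1) ≤ Real.log x :=
      Real.log_le_log (by positivity) (by exact_mod_cast hQx)
    have hlogQ1pos : 0 < Real.log ((Q : ℝ) + 1) := Real.log_pos (by
      have : (1 : ℝ) ≤ Q := by exact_mod_cast hQ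
      linarith)
    have hsL : Real.log x ≤ L := Real.log_le_log (by linarith) hxR'
    set s := Real.log x with hs
    rw [exitGamma_eq ⟨hQx, hxR⟩]
    have hRx : 1 ≤ R / x := Nat.div_pos hxR (by omega)
    -- Step 1: IH inside the sum (over Icc 1 (R/x): the n = 1 term vanishes)
    have hdrop : ∑ n ∈ Icc 2 (R / x), vonMangoldt n / n * (exitGamma R Q (x * n) / Real.log ((x * n : ℕ) : ℝ)) =
        ∑ n ∈ Icc 1 (R / x), vonMangoldt n / n * (exitGamma R Q (x * n) / Real.log ((x * n : ℕ) : ℝ)) := by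
      have hI : Icc 1 (R / x) = insert 1 (Icc 2 (R / x)) := by
        ext n; simp only [Finset.mem_insert, Finset.mem_Icc]; omega
      rw [hI, Finset.sum_insert (by simp)]
      simp [ArithmeticFunction.vonMangoldt_apply_one]
    have hsum : ∑ n ∈ Icc 1 (R / x), vonMangoldt n / n * (B * L / (s + Real.log n) ^ 2) ≤
        ∑ n ∈ Icc 1 (R / x), vonMangoldt n / n * (exitGamma R Q (x * n) / Real.log ((x * n : ℕ) : ℝ)) := by
      refine Finset.sum_le_sum fun n hn => ?_
      have hn' := Finset.mem_Icc.1 hn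
      rcases eq_or_lt_of_le hn'.1 with h1 | h1
      · -- n = 1: Λ(1) = 0, both sides vanish
        subst h1
        simp [ArithmeticFunction.vonMangoldt_apply_one]
      refine mul_le_mul_of_nonneg_left ?_ (div_nonneg ArithmeticFunction.vonMangoldt_nonneg (Nat.cast_nonneg _))
      have hxn : x * n ≤ R := by
        have := (Nat.le_div_iff_mul_le (by omega)).1 hn'.2
        rwa [mul_comm] at this
      have hn1 : (1 : ℝ) ≤ n := by exact_mod_cast hn'.1
      have hlogn : 0 ≤ Real.log n := Real.log_nonneg hn1
      have hlogxn : Real.log ((x * n : ℕ) : ℝ) = s + Real.log n := by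
        push_cast
        rw [Real.log_mul (by positivity) (by positivity)]
      have hpos : 0 < s + Real.log n := by linarith
      have hlt : x < x * n := by nlinarith
      have hQxn : Q < x * n := lt_trans hQx hlt
      have hG := ih (R + 1 - x * n) (by omega) (x * n) rfl hQxn hxn
      rw [hlogxn] at hG ⊢
      calc B * L / (s + Real.log n) ^ 2 = (B * L / (s + Real.log n)) / (s + Real.log n) := by
            rw [div_div, sq]
        _ ≤ exitGamma R Q (x * n) / (s + Real.log n) := div_le_div_of_nonneg_right hG hpos.le
    -- Step 2: the lower Abel step
    have hBL : 0 ≤ B * L := mul_nonneg hB0 hLpos.le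
    have habel := sum_vonMangoldt_div_mul_inv_sq_ge (N := R / x) hRx
      (fun n hn hnR => hψ n hn (hnR.trans (Nat.div_le_self R x))) hlogx hBL
    -- Step 3: s + log ⌊R/x⌋ ≥ L − log 2
    have hN : L - Real.log 2 ≤ s + Real.log ((R / x : ℕ) : ℝ) := by
      have h2N : (R : ℝ) ≤ 2 * ((x : ℝ) * ((R / x : ℕ) : ℝ)) := by
        have h := Nat.lt_div_mul_add (a := R) (b := x) (by omega)
        have h' : (R : ℝ) < (R / x : ℕ) * x + x := by exact_mod_cast h
        have hNx : (x : ℝ) ≤ (R / x : ℕ) * x := by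
          have : (1 : ℝ) ≤ (R / x : ℕ) := by exact_mod_cast hRx
          nlinarith
        nlinarith
      have hNpos : (0 : ℝ) < ((R / x : ℕ) : ℝ) := by exact_mod_cast hRx
      have : Real.log R ≤ Real.log 2 + (s + Real.log ((R / x : ℕ) : ℝ)) := by
        rw [hs, ← Real.log_mul (by positivity) hNpos.ne', ← Real.log_mul (by norm_num) (by positivity)]
        exact Real.log_le_log (by positivity) h2N
      linarith
    have hinv : 1 / (s + Real.log ((R / x : ℕ) : ℝ)) ≤ 1 / (L - Real.log 2) :=
      one_div_le_one_div_of_le (by linarith) hN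
    -- Step 4: the potential inequality
    have hkey : B * L / s ≤ 1 + (B * L * (1 / s - 1 / (L - Real.log 2)) - (c' + Real.log 2) * (B * L / s ^ 2)) := by
      have hs2 : Real.log ((Q : ℝ) + 1) ^ 2 ≤ s ^ 2 := pow_le_pow_left₀ hlogQ1pos.le hlogQ1 2
      have hfrac : (c' + Real.log 2) * L / s ^ 2 ≤ (c' + Real.log 2) * L / Real.log ((Q : ℝ) + 1) ^ 2 :=
        div_le_div_of_nonneg_left (by positivity) (by positivity) hs2
      have h1 : B * (L / (L - Real.log 2) + (c' + Real.log 2) * L / s ^ 2) ≤ 1 :=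
        le_trans (mul_le_mul_of_nonneg_left (by linarith) hB0) hB
      have hexp : B * L * (1 / s - 1 / (L - Real.log 2)) - (c' + Real.log 2) * (B * L / s ^ 2) =
          B * L / s - B * (L / (L - Real.log 2) + (c' + Real.log 2) * L / s ^ 2) := by
        field_simp
        ring
      rw [hexp]
      linarith
    calc B * L / s ≤ 1 + (B * L * (1 / s - 1 / (L - Real.log 2)) - (c' + Real.log 2) * (B * L / s ^ 2)) := hkey
      _ ≤ 1 + (B * L * (1 / s - 1 / (s + Real.log ((R / x : ℕ) : ℝ))) - (c' + Real.log 2) * (B * L / s ^ 2)) := by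
          nlinarith [hinv, hBL]
      _ ≤ 1 + ∑ n ∈ Icc 1 (R / x), vonMangoldt n / n * (B * L / (s + Real.log n) ^ 2) := by linarith [habel]
      _ ≤ 1 + ∑ n ∈ Icc 2 (R / x), vonMangoldt n / n * (exitGamma R Q (x * n) / Real.log ((x * n : ℕ) : ℝ)) := by
          rw [hdrop]; linarith [hsum]

end Summit.RiemannHypothesis.RiemannHypothesis.Theorems.IntegerScrew

end
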